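import Literature.AlgebraicGeometry.Resolution.SecantColonAnnihilatorCM
import Literature.AlgebraicGeometry.Resolution.SecantColonAnnihilatorTransfer
import HarnessLib

/-!
# From `𝔯 = S` to the Cohen–Macaulay clause of `KawasakiMacaulayfication`

Topic: `Literature/AlgebraicGeometry/Resolution` (linking Theorem A / `SecantColonAnnihilatorCM.lean`
to the literal Cohen–Macaulay clause of the named facts `KawasakiMacaulayfication` /
`CesnaviciusMacaulayfication`: "for every `d` with `dim R = d` and every `s : Fin d → R` whose ideal
has maximal radical, `s` is a weakly regular sequence").

* `ringKrullDim_quotient_eq_zero_of_radical_isMaximal` — `dim R/J = 0` if `√J` is maximal.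
* `isSecantSequence_ofFn_of_radical_isMaximal` — a system of parameters of a Noetherian local ring
  `R` (`d = dim R` elements with `√(s) = 𝔪`) is a secant sequence for the `R`-module `R`
  (`dim R/(s) = 0 = dim R - d` and `isSecantSequence_of_supportDim_quotient_add_length_eq`).
* `cmClause_of_secantColonAnnihilator_self_eq_top` — if `𝔯_R(R) = R` then every system of
  parameters of `R` is weakly regular.
* `cmClause_of_secantColonAnnihilator_eq_top_of_surjective` — the same from `𝔯_S(R) = S` for a
  surjection of local rings `S ↠ R` (`R` as an `S`-module; `map_secantColonAnnihilator_le`).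
* `cmClause_of_prod_annihilator_EMod_eq_top` — over a regular local `S ↠ R`: if the
  `Ext`-annihilator ideal `𝔠` of the `S`-module `R` is the unit ideal, the local ring `R` satisfies
  the Cohen–Macaulay clause (points off `V(𝔠)` are Cohen–Macaulay, [Kawasaki2000, La. 2.4 (2)] /
  [Cesnavicius2021, (AR-b)], easy inclusion).

[cite: Kawasaki2000, La. 2.4; Cesnavicius2021, §2 (AR-b); Matsumura1987, Thm. 17.4]
-/

noncomputable section

open IsLocalRing Ideal Module RingTheory.Sequence

universe u

namespace Literature.AlgebraicGeometry.Resolution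

/-! ## Systems of parameters of the ring are secant -/

section SOP

variable {R : Type u} [CommRing R]

/-- `dim R/J = 0` when `√J` is a maximal ideal: `V(J) = V(√J)` is a single point. [folklore] -/
theorem ringKrullDim_quotient_eq_zero_of_radical_isMaximal {J : Ideal R} (hJ : J.radical.IsMaximal) :
    ringKrullDim (R ⧸ J) = 0 := by
  rw [ringKrullDim_quotient]
  have hmem : (⟨J.radical, hJ.isPrime⟩ : PrimeSpectrum R) ∈ PrimeSpectrum.zeroLocus (J : Set R) :=
    fun x hx => Ideal.le_radical hx
  haveI : Unique (PrimeSpectrum.zeroLocus (J : Set R)) :=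
    { default := ⟨_, hmem⟩
      uniq := fun p => Subtype.ext (PrimeSpectrum.ext (by
        have hp : J ≤ p.1.asIdeal := fun x hx => p.2 hx
        have hrad : J.radical ≤ p.1.asIdeal := (p.1.isPrime.radical_le_iff).mpr hp
        exact (hJ.eq_of_le p.1.isPrime.ne_top hrad).symm)) }
  exact Order.krullDim_eq_zero_of_unique

variable [IsNoetherianRing R] [IsLocalRing R]

/-- **A system of parameters of a Noetherian local ring is a secant sequence** for the ring as a
module over itself: `d = dim R` elements `s` with `√(s) = 𝔪` satisfy
`dim Supp(R/(s₁,…,sᵢ)R) = d - i` for all `i` (the drops are at most one each, [Matsumura1987,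
Thm. 13.6], and total `d`). [cite: Matsumura1987, Thm. 14.1] -/
theorem isSecantSequence_ofFn_of_radical_isMaximal {d : ℕ} (hd : ringKrullDim R = d)
    (s : Fin d → R) (hs : (Ideal.span (Set.range s)).radical.IsMaximal) :
    IsSecantSequence R (List.ofFn s) := by
  have hrad : (Ideal.span (Set.range s)).radical = maximalIdeal R := IsLocalRing.eq_maximalIdeal hs
  have hmem : ∀ r ∈ List.ofFn s, r ∈ maximalIdeal R := by
    intro r hr
    obtain ⟨i, rfl⟩ := (List.mem_ofFn' s r).mp hr
    rw [← hrad]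
    exact Ideal.le_radical (Ideal.subset_span ⟨i, rfl⟩)
  refine isSecantSequence_of_supportDim_quotient_add_length_eq hmem ?_
  have hofFn : Ideal.ofList (List.ofFn s) = Ideal.span (Set.range s) := by
    apply congrArg Ideal.span; ext a; simp [List.mem_ofFn']
  have hq : (ofList (List.ofFn s) • ⊤ : Submodule R R) = (Ideal.span (Set.range s) : Submodule R R) := by
    rw [hofFn, Ideal.smul_eq_mul, Ideal.mul_top]
  rw [List.length_ofFn, supportDim_self_eq_ringKrullDim, hd,
    Module.supportDim_eq_of_equiv (Submodule.quotEquivOfEq _ _ hq),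
    supportDim_quotient_eq_ringKrullDim, ringKrullDim_quotient_eq_zero_of_radical_isMaximal hs,
    zero_add]

/-- **`𝔯_R(R) = R` gives the Cohen–Macaulay clause**: every system of parameters of the Noetherian
local ring `R` is then a weakly regular sequence. [cite: Matsumura1987, Thm. 17.4 (iii)] -/
theorem cmClause_of_secantColonAnnihilator_self_eq_top (h : secantColonAnnihilator R R = ⊤) :
    ∀ d : ℕ, ringKrullDim R = d → ∀ s : Fin d → R, (Ideal.span (Set.range s)).radical.IsMaximal →
      IsWeaklyRegular R (List.ofFn s) := by
  intro d hd s hs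
  have hrad : (Ideal.span (Set.range s)).radical = maximalIdeal R := IsLocalRing.eq_maximalIdeal hs
  refine secantColonAnnihilator_eq_top_iff.mp h _ (isSecantSequence_ofFn_of_radical_isMaximal hd s hs)
    fun r hr => ?_
  obtain ⟨i, rfl⟩ := (List.mem_ofFn' s r).mp hr
  rw [← hrad]
  exact Ideal.le_radical (Ideal.subset_span ⟨i, rfl⟩)

end SOP

/-! ## Along a surjection `S ↠ R` -/

section Surjective

variable {S R : Type u} [CommRing S] [IsLocalRing S] [CommRing R] [IsNoetherianRing R]
  [IsLocalRing R] [Algebra S R]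

/-- **`𝔯_S(R) = S` for a quotient `S ↠ R` gives the Cohen–Macaulay clause of `R`** (`𝔯_S(R)`
maps into `𝔯_R(R)`, `map_secantColonAnnihilator_le`). [cite: Matsumura1987, Thm. 17.4 (iii)] -/
theorem cmClause_of_secantColonAnnihilator_eq_top_of_surjective
    (hφ : Function.Surjective (algebraMap S R)) (h : secantColonAnnihilator S R = ⊤) :
    ∀ d : ℕ, ringKrullDim R = d → ∀ s : Fin d → R, (Ideal.span (Set.range s)).radical.IsMaximal →
      IsWeaklyRegular R (List.ofFn s) := by
  refine cmClause_of_secantColonAnnihilator_self_eq_top (top_le_iff.mp ?_)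
  have := map_secantColonAnnihilator_le hφ (M := R)
  rwa [h, Ideal.map_top] at this

end Surjective

/-! ## Off `V(𝔠)` the local rings are Cohen–Macaulay -/

section Regular

variable {S R : Type u} [CommRing S] [IsRegularLocalRing S] [CommRing R] [IsLocalRing R]
  [Algebra S R]

/-- **Points off `V(𝔠)` are Cohen–Macaulay**: for a surjection `S ↠ R` of local rings with `S`
regular of dimension `n`, a free resolution `F` of the `S`-module `R` of dimension `d`, if the
`Ext`-annihilator ideal `𝔠 = ∏_{q ∈ (n-d, max n 2]} Ann E^q` is the unit ideal then every system
of parameters of `R` is a weakly regular sequence (the Cohen–Macaulay clause of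
`KawasakiMacaulayfication`). [cite: Kawasaki2000, La. 2.4 (2); Cesnavicius2021, §2 (AR-b)] -/
theorem cmClause_of_prod_annihilator_EMod_eq_top (hφ : Function.Surjective (algebraMap S R))
    (F : FreeResolution S R) {n d : ℕ} (hn : ringKrullDim S = n)
    (hd : Module.supportDim S R = d)
    (htop : (∏ q ∈ Finset.Ioc (n - d) (max n 2), Module.annihilator S (F.EMod q)) = ⊤) :
    ∀ d' : ℕ, ringKrullDim R = d' → ∀ s : Fin d' → R,
      (Ideal.span (Set.range s)).radical.IsMaximal → IsWeaklyRegular R (List.ofFn s) := by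
  haveI : IsNoetherianRing R := isNoetherianRing_of_surjective S R (algebraMap S R) hφ
  haveI : Module.Finite S R := Module.Finite.of_surjective (Algebra.linearMap S R) hφ
  have h := prod_annihilator_EMod_le_secantColonAnnihilator F hn hd
  rw [htop, top_le_iff] at h
  exact cmClause_of_secantColonAnnihilator_eq_top_of_surjective hφ h

end Regular

end Literature.AlgebraicGeometry.Resolution

end
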